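import Summits.BirchSwinnertonDyer.BirchSwinnertonDyer.Theses.PrintCFram
import Summits.BirchSwinnertonDyer.BirchSwinnertonDyer.Theorems.PrintCFramBottomClassIndexLawFiveLeEisensteinEndStateV18
import HarnessLib

/-!
# Crux `PrintCFram.BottomClassIndexLawFiveLe` (item stmt-BirchSwinnertonDyer-20372) — line `kriz-li-cover`, v2.1
# (REBASED on the line of record v18 «MAZUR–WILES LEAVES THE PRINT LIST», kernel 267d92ade135cb4c, 2026-08-28T21:18:59Z — the class-factor split of v17
# with FOUR print facts — and COMPOSED THROUGH the LEAD's landed end-state theorem `EisensteinEndStateV18.…_of_prints4_of_krizLi_of_classFactor_of_noAdmissibleField`, p669207)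
# (ideator seat bsd-idea-7, generation g12, lens «complete» = program-completion of Kriz–Li, Forum Math. Sigma 7 (2019) e15, §8: the authors prove the
# EXISTENCE of a Heegner field passing their Bernoulli hypothesis (4) only at `p = 3` (Davenport–Heilbronn / Nakagawa–Horie / Taya, Props. 8.5–8.8) and
# leave `p ≥ 5` at a sufficient criterion (Ex. 8.4); this line types that gap on the CM-ramified class as ONE number-theory stub and cashes it against the
# line of record.)

HONEST FRAMING. Nothing is proved about BSD here: four `sorry`'d stubs, ONE kernel-checked composition `BottomClassIndexLawFiveLe_of` concluding the crux
BY NAME, and its hypothesis-taking twin `BottomClassIndexLawFiveLe_of_hyps` (the four stub STATEMENTS as binders via `type_of%`, so the kernel certifies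
the glue with the standard axioms only — critic V#120 price P1). PUBLISH-ONLY (W-79): the registry of this crux belongs to the LEAD's line of record
`eisenstein-resource-bdp-line` (v18, kernel 267d92ade135cb4c: stubs `stub_prints` (4 facts) / `stub_krizLi` / `stub_bsdp_of_classFactor` (B1) /
`stub_bsdp_of_noAdmissibleHeegnerField` (B2′)); this file is an ALTERNATIVE line, not a replacement; it adopts v18's `stub_prints`, `stub_krizLi` AND
B1 VERBATIM (same names and statements — shared credit; any closing of B1 serves both lines) and differs from v18 in exactly ONE stub: B2′ is replaced
by the COVER C, of which B2′ is the vacuous shadow; the composition IS the LEAD's landed v18 end-state theorem with `C ⟹ B2′` in B2′'s slot.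

WHAT CHANGED v1 → v2 → v2.1 (2026-08-28T21:25Z / 21:50Z; v2 = f2d51b6f22b5 was cut on v17 with its own by_cases composition; v2.1 follows the registry to v18). v1 (g11, fac6356d19638e28) was cut against v14 (locus = «a Kriz–Li DATUM exists»; residue = the research
pair Ko⁻/β1 restricted to intrinsically irregular members). The line of record has since (v15) restated the locus on CHARACTER DATA, (v16) collapsed the
residue to one stub, (v17, 25 min after v1 was published) SPLIT that residue ALONG THE CLASS FACTOR exactly as v1's cover suggested, and (v18) dropped Mazur–Wiles from the prints: B1 = «class
factor `‖B_{1,ψ⁻¹}‖_p ≤ p⁻¹` ⟹ `BSD_p`» (the INTRINSIC = Eisenstein-irregular members; inhabited: 17424bl1@11, 305809c1@7), B2′ = «unit class factor but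
EVERY Heegner `K''` (`d` odd `< −4`) has `‖B_{1,(ψε_{K''}ω⁻¹)~}‖_p ≤ p⁻¹` ⟹ `BSD_p`» (labelled by the LEAD «conjecturally VACUOUS — killed by any
horizontal indivisibility theorem for the twisted class numbers with Heegner splitting»). v2 therefore keeps B1 verbatim and replaces B2′ by the typed
horizontal indivisibility statement itself — Stub C, re-typed in the record's currency: C's binders are B2′'s binders and C's conclusion is the NEGATION of
B2′'s `∀ K''` premise, so `C ⟹ B2′` trivially and the composition never needs `BSD_p` off the Kriz–Li locus except at B1. v1's Ko⁻ᵢ/β1ᵢ are gone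
(v16–v18 superseded them); v1's hypotheses (1)/(3)/primitivity on `ψ` are gone from C (the class binders of w5's
`KrizLiBinders.exists_krizLiBinders_of_cmRamified` supply them where the (KL) branch needs them, and C is cleaner without).

THE LEVER (unchanged) — SPLIT (4) INTO ITS `K''`-FREE AND `K''`-DEPENDENT FACTORS AND SUPPLY THE FIELD. For the class's ODD character `ψ`
(`ψ = β·ω^{(p+1)/4}`, `β` the quadratic character of the twist, w2 g4 census) Kriz–Li's `ψ₀ = ψε_K`, so `b₁ := B_{1,ψ₀⁻¹ε_K} = B_{1,ψ⁻¹}` is the CLASS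
factor (free of `K''`) and `b₂(K'') := B_{1,ψ₀ω⁻¹} = B_{1,(ψε_{K''}ω⁻¹)~} = B_{1,χ_{D'}ω^{(p−3)/4}} ≡ u·B_{m,χ_{D'}}/m (mod p)`, `m = (p+1)/4`,
`D' = e*·d_{K''}` (Kummer's congruence; a Cohen–Eisenstein coefficient `H(m,|D'|)` of weight `m + 1/2`) carries all the `K''`-dependence (w3 g7's
`OffLocusResidue.not_exists_characterData_iff_classFactor_or_forall`, p665415/p666097, is this dictionary as a kernel theorem). So a member with UNIT
class factor is separated from the Kriz–Li locus ONLY by the EXISTENCE of one Heegner field `K''` of `N_W` (`d` odd `< −4`) with `p ∤ b₂(K'')` —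
Stub C — pure `GL(1)/ℚ` number theory (no elliptic curve in its conclusion; `W` enters through `N_W` and the trace congruence `hss` only).

WHAT `p ∣ b₂(K'')` MEANS (g12; the reason C is believed and the shape of its failures). Kriz–Li's congruence (29) (pp. 49–50) is an EQUALITY mod `p`:
`(|Ẽ^{ns}(𝔽_p)|/p)·log_ω P_{K''} ≡ u·b₁·b₂(K'')`. Hence for a member with unit class factor and unit-log generator `g` (level `0` in the LEAD's level
dictionary), writing `P_{K''} = n_{K''}·g + torsion`: `p ∣ b₂(K'') ⟺ p ∣ n_{K''}`. In particular EVERY Heegner field whose twist `W^{(d_{K''})}` has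
analytic rank `≥ 2` fails at every `p` (Gross–Zagier: `P_{K''}` torsion), and the remaining failures are `p ∣ [W(K''):ℤP_{K''}]`-events
(`p`-torsion in `Ш(W^{(d_{K''})})` under BSD). So C ⟺ «some Heegner field has a Heegner point of index prime to `p` modulo the generator» — a
horizontal Kolyvagin-type existence statement, at an EISENSTEIN prime (`W[p]^{ss}` reducible, `p² ∣ N_W`), where W. Zhang 2014 / CGLS 2022-type
indivisibility theorems do not reach (surjective resp. good ordinary `p`), and where the half-integral-weight non-vanishing ladder (Bruinier 1999 /
Ono–Skinner 1998 / Wiles 2015 / Beckwith 2017) prescribes local behaviour only at primes NOT dividing the level·`p` — two-corpus presearch and w3 g7's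
independent B2′ presearch (`Lines/eisenstein-resource-bdp-line-w3g7-B2prime-presearch.md`) agree: NOT IN PRINT for `p ≥ 7`; research-M.

DATA (g12, engine `pub/ideators/bsd-idea-7/g12/p3_cover_density.py`, pure Python, reproduces w2 g4's KL(4) census with 0/520 mismatches; local run
`|d_{K''}| ≤ 5000`, 63 regular window classes, 12 024 admissible pairs): EVERY regular class passes, first passing admissible `d_{K''}` at admissible
rank 1 in 51/63 classes, rank ≤ 2 in 61/63, max rank 5 (25921a1@7: −143); longest run of consecutive admissible failures 4; pass fractions
0.811/0.884/0.900/0.936/0.919/0.948 at `p` = 7/11/19/43/67/163 against `1 − 1/p` = 0.857/0.909/0.947/0.977/0.985/0.994 — the excess failure rate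
≈ 4–6 % is `p`-INDEPENDENT, as the rank-`≥ 2`-twist reading predicts (e.g. `d_{K''} = −79, −271` fail at BOTH `p = 67` and `p = 163`, and for
`χ_{−79}` the ONLY odd `p`-irregular index in `[1, p−2]` is `m = (p+1)/4` at `p = 67` and at `p = 163` — structure, not chance); exact-rational
cross-checks: `v_67(B_{17,χ_{−79}}/17) = v_163(B_{41,χ_{−79}}/41) = 1`. The two class-factor-irregular members (b₁ ≡ 0: 305809c1@7, 17424bl1@11)
are B1's, untouched by C. Job spec for the director's kit queue (`|d| ≤ 2·10⁴` + PARI `ellanalyticrank` on the failing twists at `p ≥ 43`):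
`pub/ideators/bsd-idea-7/g12/P3-jobspec.md`.

WHAT THE LINE BUYS. If C closes (number theory, one Wiles-2015-type theorem at weight `m + 1/2` with splitting prescribed AT `p`), the research
residue of C2 on BOTH lines is EXACTLY B1 — the intrinsic members (class factor non-unit ⟺ level `≥ 1` or `Ш[p] ≠ 0` by the LEAD's level
dictionary; BKNO 2026 §1.4 / barrier `CMRankOneAtRamifiedPrime`). If C is refuted (a regular member none of whose Heegner fields has `p ∤ n_{K''}`),
that member is a NAMED new inhabitant of the off-locus set with unit class factor — informative for the record's B2′ either way.

References: [KrizLi2019] Thm. 1.20 (pp. 7–8), Rem. 1.21 (p. 8), §7.1 (29) (pp. 49–50), §8 (p. 3, pp. 49–52), Ex. 8.4; [Washington1997] Thm. 5.11,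
Kummer congruences §5.3; [Wiles2015ClassGroups] Thm. 0.0.1 and the remark on p. 2; [Beckwith2017] Thm. 1.1 (arXiv:1612.04443 p. 4); [BalogDarmonOno1996]
Thm. 4 (p. 8); [Bruinier1999Duke] Thm. 1; [OnoSkinner1998Annals] Cor. 2; [GrossZagier1986] I.(6.3); [WZhang2014CambJMath] Thm. 1.1; [CGLS2022Invent]
Thm. A; [MazurWiles1984] Thm. 2 (p. 216); [BKNO2026] §1.4. BSD is not proved by any of this; 20372 is not proved; no stub is closed.
-/

set_option autoImplicit false
-- the summit namespace `Summit.BirchSwinnertonDyer.BirchSwinnertonDyer` repeats the problem name by design (D-0017)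
set_option linter.dupNamespace false

noncomputable section

open scoped Classical Pointwise

namespace Summit.BirchSwinnertonDyer.BirchSwinnertonDyer.Cruxes.BottomClassIndexLawFiveLe.KrizLiCover

open WeierstrassCurve NumberField DirichletCharacter
  Literature.NumberTheory.EllipticCurves
  Literature.NumberTheory.EllipticCurves.Rank1Residual
  Literature.NumberTheory.EllipticCurves.KrizLi2019
  Summit.BirchSwinnertonDyer.BirchSwinnertonDyer.Theses.UniversalToricDescent
  Summit.BirchSwinnertonDyer.BirchSwinnertonDyer.Theorems.RamifiedSevenEllipticUnits
  Summit.BirchSwinnertonDyer.BirchSwinnertonDyer.Theorems.PrintCFram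

/-! ## §1 The four stubs: PRINT — `stub_prints` (4 facts), `stub_krizLi` (VERBATIM v18); RESEARCH — B1 `stub_bsdp_of_classFactor` (VERBATIM v18 = v17 text, the LEAD's: the intrinsic residue) and the COVER C `stub_heegnerField_of_unitClassFactor` (this line's: number theory, B2′'s typed vacuity) -/

/-- **Stub 0 `stub_prints` (PRINT — a conjunction of FOUR refereed named facts; VERBATIM from the line of record v18; closes by citation).** Hsieh 2014
Thm. A (anticyclotomic Rankin–Selberg `p`-adic `L`-function, any level), Liu–Zhang–Zhang 2018 (Heegner vectors / `p`-adic Waldspurger at an additive prime),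
route UTD's published-input bundle `ToricPublishedInputs` (Gross–Zagier I.(6.3), Kolyvagin Thm. A, GZK, modularity, parametrisation supply, Cassels,
Gross–Zagier I.(7.3), Friedberg–Hoffstein, parity, Heegner points), Burungale–Flach 2024 Cor. 2 (BSD triple for CM curves with `L(E,1) ≠ 0`). (v18 dropped
Mazur–Wiles Thm. 2: w8 g2's MW-free engines.) Consumed only through the LEAD's landed end-state theorem
`EisensteinEndStateV18.bottomClassIndexLawFiveLe_of_prints4_of_krizLi_of_classFactor_of_noAdmissibleField` (p669207).
[cite: Hsieh2014, Thm. A p. 712 (Doc. Math. 19)] [cite: LiuZhangZhang2018, Thm 1.5.1 and Thm 1.5.3 (Duke Math. J. 167 pp. 748–749)]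
[cite: BurungaleFlach2024, Thm. 1.1 and Cor. 2] [cite: Cassels1965ArithmeticVIII] -/
theorem stub_prints :
    Hsieh2014.thmA_exists_isHsiehLFunction_unrPeriod_anyLevel ∧
    LiuZhangZhang2018.thm151_thm153_modularCurve_heegnerVector_additive ∧
    ToricPublishedInputs ∧
    bsdTriple_of_hasCM_of_L_one_ne_zero := by
  sorry

/-- **Stub KL `stub_krizLi` (PRINT — ONE refereed named fact; VERBATIM from the line of record).** Kriz–Li, Forum Math. Sigma 7 (2019) e15, Thm. 1.20
(= Thm. 7.1, first alternative): at an odd Eisenstein prime `p` (NO hypothesis on the reduction at `p`; Rem. 1.21: CM by `ℚ(√−p)` included), for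
`E[p]^{ss} ≅ 𝔽_p(ψ) ⊕ 𝔽_p(ψ⁻¹ω)` with (1)–(3) and a Heegner field `K` with `p` split and `B_{1,ψ₀⁻¹ε_K}·B_{1,ψ₀ω⁻¹} ≢ 0 (mod p)`:
`(|Ẽ^{ns}(𝔽_p)|/p)·log_{ω_E} P_K ≢ 0 (mod p)`. Consumed by the (KL) branch. Closes by citation.
[cite: KrizLi2019, Thm. 1.20 (pp. 7–8) = Thm. 7.1 (pp. 42–43), Rem. 1.17 (p. 6), Rem. 1.21 (p. 8)] -/
theorem stub_krizLi : KrizLi2019.thm120_padicLogHeegner_unit_of_bernoulli := by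
  sorry

/-- **Stub B1 `stub_bsdp_of_classFactor` — THE INTRINSIC RESIDUE [RESEARCH; VERBATIM from the line of record v18 (= v17 text; LEAD line-cfram-p1 g10,
2026-08-28T20:40:45Z) — same NAME and STATEMENT, so this is ONE stub shared by the two lines, credited to the LEAD].** For a class member `W` (`W/ℚ` CM,
`CMRamified W p`, `p ≥ 5`, `r_an(W) = 1`) and ANY odd character datum `(f, ψ, ω)` of `W` (`ψ` odd, `ω` Teichmüller, the trace congruence `hss`): if the
CLASS FACTOR is a non-unit, `‖B_{1,ψ⁻¹}‖_p ≤ p⁻¹` (by Mazur–Wiles: the `ψ`-part of the `p`-class group of `ℚ(ψ)` is non-trivial; by the LEAD's level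
dictionary: the aligned generator is `p`-divisible in `W(ℚ_p)` or `Ш(W)[p] ≠ 0`; inhabited on the window by 17424bl1@11 and 305809c1@7, w2 g4 census),
then `BSD_p(W)`. This is where ALL the beyond-print content of C2 sits once C holds: an Eisenstein-IRREGULAR rank-one `BSD_p` at the CM-ramified prime
(BKNO 2026 §1.4 is conditional there; barrier `CMRankOneAtRamifiedPrime`). Why it might fail: it does not «fail» — it is open; the risk is that it is
as hard as the crux on those members. [cite: KrizLi2019, Thm. 1.20 (p. 8), §7.1 (p. 43)] [cite: MazurWiles1984, Thm. 2 (p. 216)] [cite: BKNO2026, §1.4] -/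
theorem stub_bsdp_of_classFactor :
    ∀ (W : WeierstrassCurve ℚ) [W.IsElliptic] [W.IsGloballyMinimal] (p : ℕ) [Fact p.Prime], W.HasCM → CMRamified W p → 5 ≤ p →
      W.analyticRank = 1 → ∀ (f : ℕ) [NeZero f] (ψ : DirichletCharacter ℚ_[p] f) (ω : DirichletCharacter ℚ_[p] p), ψ.Odd →
      KrizLi2019.IsTeichmullerCharacter ω →
      (∀ ℓ : ℕ, ℓ.Prime → ¬ (ℓ ∣ p * W.conductorNorm ℤ) →
        ‖((W.LFunction ℓ : ℤ) : ℚ_[p]) - (ψ (ℓ : ZMod f) + ψ⁻¹ (ℓ : ZMod f) * ω (ℓ : ZMod p))‖ < 1) →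
      ‖KrizLi2019.bernoulliOnePrim ψ⁻¹‖ ≤ (p : ℝ)⁻¹ → BSDp W p := by
  sorry

/-- **Stub C `stub_heegnerField_of_unitClassFactor` — THE COVER [THIS LINE'S STUB; NUMBER THEORY, research-M: a horizontal non-vanishing mod `p` for ONE
twisted quadratic Bernoulli number with splitting prescribed AT `p`; B2′'s typed vacuity].** For a class member `W` (`W/ℚ` CM, `CMRamified W p`, `p ≥ 5`,
`r_an(W) = 1`) and any odd character datum `(f, ψ, ω)` of `W` with `hss` whose CLASS FACTOR is a unit (`¬ ‖B_{1,ψ⁻¹}‖_p ≤ p⁻¹`), there EXIST an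
imaginary quadratic field `K''` satisfying the Heegner hypothesis for `N_W` (every prime of `N_W` splits — in particular `p`), with `d_{K''}` odd and
`< −4`, and a Kronecker character `ε_{K''}` of it, such that the FIELD FACTOR is a unit: `¬ ‖B_{1,(ψε_{K''}ω⁻¹)~}‖_p ≤ p⁻¹`. The binders are EXACTLY
those of the record's B2′ (v17 = v18 text) and the conclusion is the negation of B2′'s `∀ K''` premise (so `C ⟹ B2′` with `BSD_p` never touched). In classical terms
(`ψ = χ_e·ω^{(p+1)/4}`, Kummer): for every fundamental `e` in the class and `p ∈ {7, 11, 19, 43, 67, 163}` with `p ∤ B_{(3p−1)/4,χ_{e*…}}`-type class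
factor a unit, SOME fundamental `D' = e*·d` with `d` odd `< −4`, `(d/q) = 1` for all `q ∣ N_W`, has `p ∤ B_{m,χ_{D'}}/m`, `m = (p+1)/4` — i.e. `p ∤ H(m,|D'|)`.
WHY PLAUSIBLY TRUE: (i) data — all 63 regular window classes pass at admissible rank ≤ 5, 12 024 admissible pairs at `|d| ≤ 5000` pass at rate
0.81–0.95 with failure runs ≤ 4 (module docstring); (ii) structure — by Kriz–Li (29) read as an equality, failing fields are exactly those where the
Heegner point has index divisible by `p` modulo the generator (all rank-`≥ 2` twists, plus `p`-torsion-in-`Ш(W^{(d)})` events), and no mechanism makes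
EVERY admissible twist of a regular member fail; (iii) the `p = 3` analogue is Kriz–Li Props. 8.5–8.8. WHY IT MIGHT FAIL: a regular member all of whose
Heegner fields have `p ∣ n_{K''}` is excluded by nothing in print (it would be a counterexample to a horizontal Kolyvagin-indivisibility expectation at
an Eisenstein prime); and the PROOF needs local control AT the level prime `p` (split) and at `q ∣ N_W`, which Bruinier/Ono–Skinner/Wiles/Beckwith do
not provide («`ℓ ∉ S`», «`p_i ∤ Nℓ`»). Size: research-M (one theorem of Wiles-2015 type at weight `m + 1/2`, or a Kolyvagin-system argument at a
reducible prime). Cheapest falsifier: the kit job of `P3-jobspec.md` (a regular class with no admissible `|d| ≤ 2·10⁴`; none at `5·10³`).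
[cite: KrizLi2019, §8 (p. 3, pp. 49–52), Ex. 8.4, (29) pp. 49–50] [cite: Wiles2015ClassGroups, Thm. 0.0.1, remark p. 2] [cite: Beckwith2017, Thm. 1.1 (arXiv:1612.04443 p. 4)]
[cite: Bruinier1999Duke, Thm. 1] [cite: OnoSkinner1998Annals, Cor. 2] [cite: BalogDarmonOno1996, Thm. 4 (p. 8)] [cite: Washington1997, Thm. 5.11, §5.3] -/
theorem stub_heegnerField_of_unitClassFactor :
    ∀ (W : WeierstrassCurve ℚ) [W.IsElliptic] [W.IsGloballyMinimal] (p : ℕ) [Fact p.Prime], W.HasCM → CMRamified W p → 5 ≤ p →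
      W.analyticRank = 1 → ∀ (f : ℕ) [NeZero f] (ψ : DirichletCharacter ℚ_[p] f) (ω : DirichletCharacter ℚ_[p] p), ψ.Odd →
      KrizLi2019.IsTeichmullerCharacter ω →
      (∀ ℓ : ℕ, ℓ.Prime → ¬ (ℓ ∣ p * W.conductorNorm ℤ) →
        ‖((W.LFunction ℓ : ℤ) : ℚ_[p]) - (ψ (ℓ : ZMod f) + ψ⁻¹ (ℓ : ZMod f) * ω (ℓ : ZMod p))‖ < 1) →
      ¬ ‖KrizLi2019.bernoulliOnePrim ψ⁻¹‖ ≤ (p : ℝ)⁻¹ →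
      ∃ (K : Type) (_ : Field K) (_ : NumberField K) (εK : DirichletCharacter ℚ_[p] (NumberField.discr K).natAbs),
        IsImaginaryQuadratic K ∧ SatisfiesHeegnerHypothesis (W.conductorNorm ℤ) K ∧ Odd (NumberField.discr K) ∧
        NumberField.discr K < -4 ∧ KrizLi2019.IsKroneckerCharacterOf K εK ∧
        ¬ ‖KrizLi2019.bernoulliOnePrim (KrizLi2019.bernoulliCharTwo ψ εK ω)‖ ≤ (p : ℝ)⁻¹ := by
  sorry

/-! ## §2 The kernel-checked composition = registry v18 ∘ (C ⟹ B2′): the LEAD's landed end-state theorem `EisensteinEndStateV18.bottomClassIndexLawFiveLe_of_prints4_of_krizLi_of_classFactor_of_noAdmissibleField` (p669207) fed with `stub_prints`, `stub_krizLi`, B1 and — in B2′'s slot — the five-line consequence of the COVER C -/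

/-- **C ⟹ B2′ (the record's `stub_bsdp_of_noAdmissibleHeegnerField`, VERBATIM type), pointwise and trivially: B2′'s premise «every Heegner field of `N_W`
with `d` odd `< −4` and every Kronecker character has a NON-unit field factor» contradicts the field C hands, so B2′'s conclusion `BSD_p W p` is reached by
`absurd` — B2′ is DISCHARGED by C, never used with content.** No `sorry`; axioms = the standard trio. BSD is not proved by any of this.
[cite: KrizLi2019, Thm. 1.20 (pp. 7–8) and §8 (pp. 49–52)] -/
theorem bsdp_of_noAdmissibleHeegnerField_of_cover (hC : type_of% @stub_heegnerField_of_unitClassFactor) :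
    ∀ (W : WeierstrassCurve ℚ) [W.IsElliptic] [W.IsGloballyMinimal] (p : ℕ) [Fact p.Prime], W.HasCM → CMRamified W p → 5 ≤ p → W.analyticRank = 1 → ∀ (f : ℕ) [NeZero f] (ψ : DirichletCharacter ℚ_[p] f) (ω : DirichletCharacter ℚ_[p] p), ψ.Odd → KrizLi2019.IsTeichmullerCharacter ω → (∀ ℓ : ℕ, ℓ.Prime → ¬ (ℓ ∣ p * W.conductorNorm ℤ) → ‖((W.LFunction ℓ : ℤ) : ℚ_[p]) - (ψ (ℓ : ZMod f) + ψ⁻¹ (ℓ : ZMod f) * ω (ℓ : ZMod p))‖ < 1) → ¬ ‖KrizLi2019.bernoulliOnePrim ψ⁻¹‖ ≤ (p : ℝ)⁻¹ → (∀ (K : Type) [Field K] [NumberField K], IsImaginaryQuadratic K → SatisfiesHeegnerHypothesis (W.conductorNorm ℤ) K → Odd (NumberField.discr K) → NumberField.discr K < -4 → ∀ εK : DirichletCharacter ℚ_[p] (NumberField.discr K).natAbs, KrizLi2019.IsKroneckerCharacterOf K εK → ‖KrizLi2019.bernoulliOnePrim (KrizLi2019.bernoulliCharTwo ψ εK ω)‖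 ≤ (p : ℝ)⁻¹) → BSDp W p := by
  intro W _ _ p _ hCM hram h5 hr f _ ψ ω hodd hω hss hcls hall
  obtain ⟨K, iK, iK', εK, hK, hH, hoddK, hd4, hεK, hfld⟩ := hC W p hCM hram h5 hr f ψ ω hodd hω hss hcls
  exact absurd (@hall K iK iK' hK hH hoddK hd4 εK hεK) hfld

/-- **COMPOSITION, HYPOTHESIS-TAKING FORM `BottomClassIndexLawFiveLe_of_hyps` (critic V#120 P1): the four stub STATEMENTS as binders (`type_of%` of the
stubs, so the text cannot drift) ⟹ the crux; `#print axioms` = {propext, Classical.choice, Quot.sound}.** = the LEAD's landed v18 end state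
`EisensteinEndStateV18.bottomClassIndexLawFiveLe_of_prints4_of_krizLi_of_classFactor_of_noAdmissibleField` (split on Kriz–Li character data; (KL) w6 g2 +
v14's branch on the MW-free engines; (¬KL) the class's odd character (w5), w3 g7's class-factor split, B1 or B2′, k7r-c4) with B2′ := C ⟹ B2′
(`bsdp_of_noAdmissibleHeegnerField_of_cover`). So this line's stub set {prints, krizLi, B1, C} implies the record's {prints, krizLi, B1, B2′} in the kernel,
and its only non-registry research content is C. The GZK antecedent of the crux is not used. BSD is not proved by any of this.
[cite: KrizLi2019, Thm. 1.20 (pp. 7–8), §7.1 (p. 43), §8] [cite: Miller2011LMS, Def. 1.1 (arXiv:1010.2431 p. 3)] [cite: Cassels1965ArithmeticVIII] -/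
theorem BottomClassIndexLawFiveLe_of_hyps
    (hprints : type_of% @stub_prints) (hKL : type_of% @stub_krizLi)
    (hB1 : type_of% @stub_bsdp_of_classFactor) (hC : type_of% @stub_heegnerField_of_unitClassFactor) :
    Summit.BirchSwinnertonDyer.BirchSwinnertonDyer.Theses.PrintCFram.BottomClassIndexLawFiveLe :=
  Theorems.PrintCFram.EisensteinEndStateV18.bottomClassIndexLawFiveLe_of_prints4_of_krizLi_of_classFactor_of_noAdmissibleField
    hprints hKL hB1 (bsdp_of_noAdmissibleHeegnerField_of_cover hC)

/-- **COMPOSITION `BottomClassIndexLawFiveLe_of` (stub-fed; concludes the crux BY NAME): `BottomClassIndexLawFiveLe_of_hyps` at the four stubs.**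
CONDITIONAL on the four stubs; no `sorry` in this proof. BSD is not proved by any of this. [cite: KrizLi2019, Thm. 1.20 (pp. 7–8) and §8] -/
theorem BottomClassIndexLawFiveLe_of :
    Summit.BirchSwinnertonDyer.BirchSwinnertonDyer.Theses.PrintCFram.BottomClassIndexLawFiveLe :=
  BottomClassIndexLawFiveLe_of_hyps stub_prints stub_krizLi stub_bsdp_of_classFactor stub_heegnerField_of_unitClassFactor

/-! ## §3 Audit -/
#print axioms bsdp_of_noAdmissibleHeegnerField_of_cover
#print axioms BottomClassIndexLawFiveLe_of_hyps
#print axioms BottomClassIndexLawFiveLe_of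

end Summit.BirchSwinnertonDyer.BirchSwinnertonDyer.Cruxes.BottomClassIndexLawFiveLe.KrizLiCover

end
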